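import Mathlib.Algebra.BigOperators.Ring.Finset
import Mathlib.Algebra.BigOperators.Field
import Mathlib.Algebra.Order.BigOperators.Group.Finset
import Mathlib.Data.Fintype.BigOperators
import Mathlib.Data.Real.Basic
import Mathlib.Analysis.SpecialFunctions.Pow.Real
import Mathlib.Tactic.Linarith
import Mathlib.Tactic.Positivity
import Mathlib.Tactic.FieldSimp
import Mathlib.Tactic.Ring
import HarnessLib

/-!
# Uniform probabilities of Boolean events on finite types: the hybrid-argument toolkit

Elementary counting lemmas for distinguishing arguments over finite uniform probability spaces
(Goldreich 2001, §3.2.3 "hybrid arguments"; Arora–Barak 2009, proof of Thm. 9.11), in the exact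
counting style of the tree's `prgAdvantage` / `ddhAdvantage` (a probability is a quotient of
cardinalities in `ℝ`):

* `uProb E = #{ω | E ω} / |Ω|` for a Boolean event `E : Ω → Bool` on a `Fintype`;
* invariance under equivalences (`uProb_comp_equiv`) and under padding with unused independent
  coordinates (`uProb_fst`, `uProb_snd`);
* Fubini / averaging over a product (`uProb_prod_eq_avg`) and the resulting "fix the shared
  randomness" bound (`abs_uProb_prod_sub_le`);
* the telescoping (hybrid) inequality `|Pr[H₀] - Pr[H_k]| ≤ ∑_{i<k} |Pr[Hᵢ] - Pr[Hᵢ₊₁]|`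
  (`abs_uProb_sub_le_sum`);
* the two-point computations on `Bool` and on `S × Bool` used when one coordinate is resampled
  (`uProb_bool`, `uProb_prod_bool`).

Everything is proved from Mathlib; no new notions beyond the abbreviation `uProb`.

## References

* O. Goldreich, *Foundations of Cryptography I*, CUP 2001, §3.2.3 (hybrid arguments).
* S. Arora, B. Barak, *Computational Complexity: A Modern Approach*, CUP 2009, Thm. 9.11 (proof).
-/

noncomputable section

namespace Literature.Computability.Cryptography

open Finset

variable {Ω Ω' : Type*} [Fintype Ω] [Fintype Ω']

/-- The probability of the Boolean event `E` under the uniform distribution on the finite type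
`Ω`: `#{ω | E ω = 1} / |Ω|` (value `0` on an empty type). [folklore] -/
def uProb (E : Ω → Bool) : ℝ := (#{ω : Ω | E ω = true} : ℝ) / Fintype.card Ω

/-- Probabilities are nonnegative. [folklore] -/
theorem uProb_nonneg (E : Ω → Bool) : 0 ≤ uProb E := by
  unfold uProb; positivity

/-- Probabilities are at most `1`. [folklore] -/
theorem uProb_le_one (E : Ω → Bool) : uProb E ≤ 1 := by
  unfold uProb
  rcases Nat.eq_zero_or_pos (Fintype.card Ω) with h | h
  · simp [h]
  · rw [div_le_one (by exact_mod_cast h)]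
    exact_mod_cast (card_filter_le _ _).trans (card_univ (α := Ω)).le

/-- Two probabilities differ by at most `1`. [folklore] -/
theorem abs_uProb_sub_uProb_le_one (E : Ω → Bool) (E' : Ω' → Bool) : |uProb E - uProb E'| ≤ 1 := by
  rw [abs_sub_le_iff]
  constructor <;> linarith [uProb_nonneg E, uProb_le_one E, uProb_nonneg E', uProb_le_one E']

/-- The count of an event as a sum of indicators. [folklore] -/
theorem card_filter_eq_sum_toNat (E : Ω → Bool) :
    (#{ω : Ω | E ω = true} : ℝ) = ∑ ω, ((E ω).toNat : ℝ) := by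
  rw [Finset.card_filter, Nat.cast_sum]
  refine Finset.sum_congr rfl fun ω _ => ?_
  cases E ω <;> simp

/-- Pointwise equal events have equal probability. [folklore] -/
theorem uProb_congr {E E' : Ω → Bool} (h : ∀ ω, E ω = E' ω) : uProb E = uProb E' := by
  unfold uProb; simp_rw [h]

/-- **Invariance under relabelling**: transporting an event along an equivalence of sample
spaces does not change its probability. [folklore] -/
theorem uProb_comp_equiv (e : Ω' ≃ Ω) (E : Ω → Bool) : uProb (fun ω' => E (e ω')) = uProb E := by
  unfold uProb
  rw [Fintype.card_congr e]
  congr 2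
  refine card_equiv e ?_
  intro ω'
  simp

/-- **Unused coordinates**: an event that ignores an independent uniform coordinate has the same
probability with or without it (first factor). [folklore] -/
theorem uProb_fst [Nonempty Ω'] (E : Ω → Bool) : uProb (fun p : Ω × Ω' => E p.1) = uProb E := by
  unfold uProb
  have h : (univ.filter fun p : Ω × Ω' => E p.1 = true) = (univ.filter fun ω : Ω => E ω = true) ×ˢ (univ : Finset Ω') := by
    ext p; simp
  rw [h, card_product, Fintype.card_prod, card_univ, Nat.cast_mul, Nat.cast_mul]
  have hpos : (0 : ℝ) < Fintype.card Ω' := by exact_mod_cast Fintype.card_pos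
  rcases Nat.eq_zero_or_pos (Fintype.card Ω) with h0 | h0
  · simp [h0]
  · field_simp

/-- Unused coordinates (second factor). [folklore] -/
theorem uProb_snd [Nonempty Ω] (E : Ω' → Bool) : uProb (fun p : Ω × Ω' => E p.2) = uProb E := by
  rw [← uProb_comp_equiv (Equiv.prodComm Ω' Ω) (fun p : Ω × Ω' => E p.2)]
  exact uProb_fst E

/-- **Averaging (Fubini)**: the probability of an event on a product is the average over the
first coordinate of the conditional probabilities. [folklore] -/
theorem uProb_prod_eq_avg (E : Ω × Ω' → Bool) :
    uProb E = (∑ a : Ω, uProb (fun b : Ω' => E (a, b))) / Fintype.card Ω := by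
  unfold uProb
  rw [card_filter_eq_sum_toNat, Fintype.sum_prod_type, Fintype.card_prod, Nat.cast_mul]
  simp_rw [card_filter_eq_sum_toNat]
  rcases Nat.eq_zero_or_pos (Fintype.card Ω') with h0 | h0
  · haveI : IsEmpty Ω' := Fintype.card_eq_zero_iff.1 h0
    simp
  · rw [← Finset.sum_div, div_div, mul_comm]

/-- **Fixing the shared randomness**: if, for every value of the shared first coordinate, two
events have conditional probabilities within `c`, then their probabilities are within `c`
(the remaining coordinates may live in different spaces). [folklore] -/
theorem abs_uProb_prod_sub_le {A B : Type*} [Fintype A] [Fintype B]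
    {E : Ω × A → Bool} {E' : Ω × B → Bool} {c : ℝ}
    (hc : 0 ≤ c) (h : ∀ a : Ω, |uProb (fun b : A => E (a, b)) - uProb (fun b : B => E' (a, b))| ≤ c) :
    |uProb E - uProb E'| ≤ c := by
  rw [uProb_prod_eq_avg E, uProb_prod_eq_avg E', ← sub_div, ← Finset.sum_sub_distrib]
  rcases Nat.eq_zero_or_pos (Fintype.card Ω) with h0 | h0
  · simp [h0, hc]
  · have hpos : (0 : ℝ) < Fintype.card Ω := by exact_mod_cast h0
    rw [abs_div, abs_of_pos hpos, div_le_iff₀ hpos]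
    calc |∑ a : Ω, (uProb (fun b => E (a, b)) - uProb (fun b => E' (a, b)))|
        ≤ ∑ a : Ω, |uProb (fun b => E (a, b)) - uProb (fun b => E' (a, b))| := abs_sum_le_sum_abs _ _
      _ ≤ ∑ _a : Ω, c := Finset.sum_le_sum fun a _ => h a
      _ = c * Fintype.card Ω := by rw [Finset.sum_const, card_univ, nsmul_eq_mul, mul_comm]

/-- The same with the shared randomness in the second coordinate. [folklore] -/
theorem abs_uProb_prod_sub_le' {A B : Type*} [Fintype A] [Fintype B]
    {E : A × Ω' → Bool} {E' : B × Ω' → Bool} {c : ℝ}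
    (hc : 0 ≤ c) (h : ∀ b : Ω', |uProb (fun a : A => E (a, b)) - uProb (fun a : B => E' (a, b))| ≤ c) :
    |uProb E - uProb E'| ≤ c := by
  rw [← uProb_comp_equiv (Equiv.prodComm Ω' A) E, ← uProb_comp_equiv (Equiv.prodComm Ω' B) E']
  exact abs_uProb_prod_sub_le hc fun b => by simpa using h b

/-- **The hybrid (telescoping) inequality**: the distance between the extreme hybrids is at
most the sum of the distances between consecutive ones (Goldreich 2001, §3.2.3). [cite: Goldreich2001, §3.2.3] -/
theorem abs_uProb_sub_le_sum (H : ℕ → Ω → Bool) (k : ℕ) :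
    |uProb (H 0) - uProb (H k)| ≤ ∑ i ∈ range k, |uProb (H i) - uProb (H (i + 1))| := by
  induction k with
  | zero => simp
  | succ k ih =>
    rw [Finset.sum_range_succ]
    calc |uProb (H 0) - uProb (H (k + 1))|
        = |(uProb (H 0) - uProb (H k)) + (uProb (H k) - uProb (H (k + 1)))| := by ring_nf
      _ ≤ |uProb (H 0) - uProb (H k)| + |uProb (H k) - uProb (H (k + 1))| := abs_add_le _ _
      _ ≤ _ := by linarith

/-- If every consecutive gap of a hybrid chain of length `k` is at most `c`, the extreme
hybrids are within `k · c`. [cite: Goldreich2001, §3.2.3] -/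
theorem abs_uProb_sub_le_mul (H : ℕ → Ω → Bool) (k : ℕ) {c : ℝ}
    (h : ∀ i < k, |uProb (H i) - uProb (H (i + 1))| ≤ c) :
    |uProb (H 0) - uProb (H k)| ≤ k * c := by
  refine (abs_uProb_sub_le_sum H k).trans ?_
  calc ∑ i ∈ range k, |uProb (H i) - uProb (H (i + 1))| ≤ ∑ _i ∈ range k, c :=
        Finset.sum_le_sum fun i hi => h i (mem_range.1 hi)
    _ = k * c := by rw [Finset.sum_const, card_range, nsmul_eq_mul]

/-- **Two points**: the uniform probability of an event on `Bool`. [folklore] -/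
theorem uProb_bool (E : Bool → Bool) : uProb E = (((E false).toNat : ℝ) + (E true).toNat) / 2 := by
  unfold uProb
  rw [card_filter_eq_sum_toNat, Fintype.sum_bool, Fintype.card_bool]
  push_cast; ring

/-- **Resampling one bit**: on `S × Bool` with the bit uniform, the probability of an event is
the average of its two sections. [folklore] -/
theorem uProb_prod_bool {S : Type*} [Fintype S] (E : S × Bool → Bool) :
    uProb E = (uProb (fun s : S => E (s, false)) + uProb (fun s : S => E (s, true))) / 2 := by
  rw [← uProb_comp_equiv (Equiv.prodComm Bool S) E, uProb_prod_eq_avg]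
  rw [Fintype.sum_bool, Fintype.card_bool]
  simp [Equiv.prodComm_apply, add_comm]

/-- The probability of an event as an average of indicator values. [folklore] -/
theorem uProb_eq_sum_div (E : Ω → Bool) : uProb E = (∑ ω, ((E ω).toNat : ℝ)) / Fintype.card Ω := by
  unfold uProb; rw [card_filter_eq_sum_toNat]

/-- On a uniform `s ∈ S`, the probability that a test `e` accepts the bit `h s` is
`p · e(1) + (1 - p) · e(0)` with `p = Pr_s[h s]`. [folklore] -/
theorem uProb_comp_bit {S : Type*} [Fintype S] [Nonempty S] (h : S → Bool) (e : Bool → Bool) :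
    uProb (fun s : S => e (h s)) = uProb h * (e true).toNat + (1 - uProb h) * (e false).toNat := by
  have hS : (0 : ℝ) < Fintype.card S := by exact_mod_cast Fintype.card_pos
  have hsum : ∑ s : S, ((e (h s)).toNat : ℝ) =
      (∑ s : S, ((h s).toNat : ℝ)) * (e true).toNat +
        (Fintype.card S - ∑ s : S, ((h s).toNat : ℝ)) * (e false).toNat := by
    have : ∀ s : S, ((e (h s)).toNat : ℝ) =
        ((h s).toNat : ℝ) * (e true).toNat + (1 - (h s).toNat) * (e false).toNat := by
      intro s; cases h s <;> simp
    simp_rw [this]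
    rw [Finset.sum_add_distrib, ← Finset.sum_mul, ← Finset.sum_mul, Finset.sum_sub_distrib,
      Finset.sum_const, card_univ, nsmul_eq_mul, mul_one]
  rw [uProb_eq_sum_div, uProb_eq_sum_div, hsum, add_div, mul_div_right_comm, mul_div_right_comm,
    sub_div, div_self hS.ne']

/-- **Biased versus fair bit, one test**: `|Pr_s[e (h s)] - Pr_b[e b]| ≤ |Pr_s[h s] - 1/2|`.
[folklore] -/
theorem abs_uProb_comp_bit_sub_le {S : Type*} [Fintype S] [Nonempty S] (h : S → Bool) (e : Bool → Bool) :
    |uProb (fun s : S => e (h s)) - uProb e| ≤ |uProb h - 1 / 2| := by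
  rw [uProb_comp_bit, uProb_bool]
  have h1 : ((e true).toNat : ℝ) ≤ 1 := by cases e true <;> simp
  have h0 : ((e false).toNat : ℝ) ≤ 1 := by cases e false <;> simp
  have h1' : (0 : ℝ) ≤ (e true).toNat := by positivity
  have h0' : (0 : ℝ) ≤ (e false).toNat := by positivity
  have : uProb h * (e true).toNat + (1 - uProb h) * (e false).toNat -
      (((e false).toNat : ℝ) + (e true).toNat) / 2 =
      (uProb h - 1 / 2) * ((e true).toNat - (e false).toNat) := by ring
  rw [this, abs_mul]
  calc |uProb h - 1 / 2| * |((e true).toNat : ℝ) - (e false).toNat|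
      ≤ |uProb h - 1 / 2| * 1 := by
        refine mul_le_mul_of_nonneg_left ?_ (abs_nonneg _)
        rw [abs_sub_le_iff]; constructor <;> linarith
    _ = _ := mul_one _

/-- **Biased versus fair bit**: replacing a fair bit by the bit `h s` of a uniform `s ∈ S`
changes the probability of any event `E(rest, bit)` by at most the bias `|Pr_s[h s] - 1/2|`
(the one-coordinate step of the coupling between i.i.d. biased bits and uniform bits). [folklore] -/
theorem abs_uProb_bias_step {S R : Type*} [Fintype S] [Fintype R] [Nonempty S]
    (h : S → Bool) (E : R → Bool → Bool) :
    |uProb (fun p : R × S => E p.1 (h p.2)) - uProb (fun p : R × Bool => E p.1 p.2)|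
      ≤ |uProb h - 1 / 2| := by
  exact abs_uProb_prod_sub_le (E := fun p : R × S => E p.1 (h p.2))
    (E' := fun p : R × Bool => E p.1 p.2) (abs_nonneg _) fun r => abs_uProb_comp_bit_sub_le h (E r)

end Literature.Computability.Cryptography

end
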